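import Mathlib
import Summits.NavierStokesRegularity.NavierStokesRegularity.Theorems.EulerZoomLiouvillePowerGaugeEulerLiouvilleDSSSimilarityDepletion
import HarnessLib.Audit

/-!
# Crux E `PowerGaugeEulerLiouville` (stmt-NavierStokesRegularity-19832): TAME DSS MEMBERS WITH A SUB-BERNOULLI PRESSURE CLOCK AND DEPLETED
# SELF-SIMILAR PARTICLE PATHS ARE TRIVIAL (the K-A″ DSS stratum with the geometric-depletion node clause; width seat ns-cas-k2 g2)

Route `EulerZoomLiouville` (NavierStokesRegularity), crux E.  `…DSSSimilarityBernoulliMember` / `…DSSSimilarityPressure` with the node clause sharpened by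
`…DSSSimilarityDepletion`: at a VORTICAL exactly self-similar particle path only Chae's stretching rate along the vorticity is required to be subcritical,
`(−t)⟪∇u ω, ω⟫ ≤ κ‖ω‖²` (`ω = ω(t,(−t)ⁿy*) ≠ 0`), the full form `(−t)⟪∇u v, v⟫ ≤ κ‖v‖²` only at NON-VORTICAL ones.
* `dss_curl_eq_zero_of_confined_depletion` — confined backward trajectories of such members carry no vorticity;
* `ae_eq_zero_of_gauge_of_dss_of_clock_depletion` — crux hypotheses (every `ρ > 0`) + classical + velocity and pressure DSS laws + tame + pressure clock
  (`θ < 1`) + depleted permanent nodes (one `κ < 1` per ball) ⇒ `u = 0` a.e.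

WHAT THIS IS NOT: not NS regularity, not the crux E — DSS members violating the pressure clock, or carrying a self-similar particle path that is vortical with
critical stretching ALONG ITS VORTICITY (or non-vortical with a critical strain direction), are untouched. [folklore; Chae2010 Thm 1.1 (the rate `α`)]
-/

noncomputable section

set_option linter.dupNamespace false

open MeasureTheory Set Filter Topology Metric Function
open scoped NNReal ENNReal ContDiff InnerProductSpace RealInnerProductSpace

namespace Summit.NavierStokesRegularity.NavierStokesRegularity.Theorems.PowerGaugeEulerLiouville.SimilarityBernoulli

open Literature.Analysis Literature.Analysis.FluidPDE Literature.Analysis.FunctionSpaces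
open Summit.NavierStokesRegularity.NavierStokesRegularity.Theorems.PowerGaugeEulerLiouville.VorticityBirth
open Summit.NavierStokesRegularity.NavierStokesRegularity.Theorems.PowerGaugeEulerLiouville.MovingSpherePiercing

variable {u : ℝ → EuclideanSpace ℝ (Fin 3) → EuclideanSpace ℝ (Fin 3)} {p : ℝ → EuclideanSpace ℝ (Fin 3) → ℝ} {θ ρ l : ℝ}

/-- **DSS, DEPLETION FORM: CONFINED BACKWARD TRAJECTORIES CARRY NO VORTICITY.**  As `dss_curl_eq_zero_of_confined` (global Type-I `K`, pressure clock, pressure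
bounds on the moving ball of radius `R`), with the node clause in depletion form: vortical permanent nodes of the ball have Chae's rate `≤ κ`, non-vortical
ones the full form `≤ κ` (`κ < 1`). [folklore] -/
theorem dss_curl_eq_zero_of_confined_depletion (hcl : IsClassicalEulerSolutionOn (Iio 0) 0 u p) (hρ : 0 < ρ) (hl : 1 < l)
    (hdss : ∀ τ : ℝ, τ < 0 → ∀ y, u τ y = (l ^ (1 + ρ)) • u ((l ^ (2 + ρ)) * τ) (l • y))
    {K : ℝ} (hK : ∀ s : ℝ, s < 0 → ∀ y : EuclideanSpace ℝ (Fin 3),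
      (-s) * ‖fderiv ℝ (u s) y‖ ≤ K ∧ (-s) ^ (1 - (2 + ρ)⁻¹) * ‖u s y‖ ≤ K)
    (hθ : θ < 1)
    (hclock : ∀ s : ℝ, s < 0 → ∀ x : EuclideanSpace ℝ (Fin 3),
      (-s) * timeDerivWithin (Iio 0) p s x - (2 + ρ)⁻¹ * fderiv ℝ (p s) x x - 2 * (1 - (2 + ρ)⁻¹) * p s x ≤
        θ * (1 - 2 * (2 + ρ)⁻¹) * ‖u s x + ((2 + ρ)⁻¹ / (-s)) • x‖ ^ 2)
    {R P₀ G κ : ℝ} (hκ : κ < 1)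
    (hP₀ : ∀ s : ℝ, s < 0 → ∀ x : EuclideanSpace ℝ (Fin 3), ‖x‖ ≤ R * (-s) ^ (2 + ρ)⁻¹ →
      (-s) ^ (2 - 2 * (2 + ρ)⁻¹) * p s x ≤ P₀)
    (hG : ∀ s : ℝ, s < 0 → ∀ x : EuclideanSpace ℝ (Fin 3), ‖x‖ ≤ R * (-s) ^ (2 + ρ)⁻¹ →
      (-s) ^ (2 - (2 + ρ)⁻¹) * ‖gradient (p s) x‖ ≤ G)
    (hnodeV : ∀ y : EuclideanSpace ℝ (Fin 3), ‖y‖ ≤ R →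
      (∀ t : ℝ, t < 0 → u t ((-t) ^ (2 + ρ)⁻¹ • y) = (-((2 + ρ)⁻¹ * (-t) ^ ((2 + ρ)⁻¹ - 1))) • y) →
      ∀ t : ℝ, t < 0 → curl (u t) ((-t) ^ (2 + ρ)⁻¹ • y) ≠ 0 →
        (-t) * ⟪fderiv ℝ (u t) ((-t) ^ (2 + ρ)⁻¹ • y) (curl (u t) ((-t) ^ (2 + ρ)⁻¹ • y)), curl (u t) ((-t) ^ (2 + ρ)⁻¹ • y)⟫ ≤
          κ * ‖curl (u t) ((-t) ^ (2 + ρ)⁻¹ • y)‖ ^ 2)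
    (hnode0 : ∀ y : EuclideanSpace ℝ (Fin 3), ‖y‖ ≤ R →
      (∀ t : ℝ, t < 0 → u t ((-t) ^ (2 + ρ)⁻¹ • y) = (-((2 + ρ)⁻¹ * (-t) ^ ((2 + ρ)⁻¹ - 1))) • y) →
      ∀ t : ℝ, t < 0 → curl (u t) ((-t) ^ (2 + ρ)⁻¹ • y) = 0 → ∀ v : EuclideanSpace ℝ (Fin 3),
        (-t) * ⟪fderiv ℝ (u t) ((-t) ^ (2 + ρ)⁻¹ • y) v, v⟫ ≤ κ * ‖v‖ ^ 2)
    {τ₀ : ℝ} (hτ₀ : τ₀ < 0) {x₀ : EuclideanSpace ℝ (Fin 3)}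
    (hconf : ∀ s : ℝ, s ≤ τ₀ → ‖ODE.evolutionMap u τ₀ s x₀‖ ≤ R * (-s) ^ (2 + ρ)⁻¹) :
    curl (u τ₀) x₀ = 0 := by
  have hρ2 : 0 < 2 + ρ := by linarith
  set n : ℝ := (2 + ρ)⁻¹ with hn
  have hn0 : 0 ≤ n := (inv_pos.2 hρ2).le
  have hn2 : n < 1 / 2 := by
    rw [hn, inv_lt_comm₀ hρ2 (by norm_num)]; norm_num; linarith
  have hΛc : ContinuousOn (fun s : ℝ => K / (-s)) (Iio 0) :=
    continuousOn_const.div continuousOn_neg fun s hs => by rw [mem_Iio] at hs; linarith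
  have hΛ : ∀ s : ℝ, s < 0 → ∀ y, ‖fderiv ℝ (u s) y‖ ≤ K / (-s) := fun s hs y => by
    rw [le_div_iff₀ (by linarith), mul_comm]; exact (hK s hs y).1
  have hlip : ODE.IsUniformlyLipschitzOn u (Iio 0) := isUniformlyLipschitzOn hcl hΛc hΛ
  set X : ℝ → EuclideanSpace ℝ (Fin 3) := fun s => ODE.evolutionMap u τ₀ s x₀ with hX
  have hXd : ∀ s : ℝ, s < 0 → HasDerivAt X (u s (X s)) s := fun s hs =>
    hlip.hasDerivAt_evolutionMap (convex_Iio 0) hτ₀ (Iio_mem_nhds hs) x₀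
  have hconf' : ∀ s : ℝ, s ≤ τ₀ → ‖X s‖ ≤ R * (-s) ^ n := hconf
  have hrest := tendsto_similaritySpeed_zero_of_clock hcl hn0 hn2 hθ hclock hτ₀ hXd hconf'
    (fun s hs => (hK s (by linarith) (X s)).2) (fun s hs => hP₀ s (by linarith) (X s) (hconf' s hs))
    (fun s hs => hG s (by linarith) (X s) (hconf' s hs))
  have hκ' : κ < (1 + κ) / 2 := by linarith
  obtain ⟨σ₁, hσ₁τ, hsub⟩ := eventually_subcriticalAlong_of_permanentNodes hcl hl hρ2 hdss hκ' hXd hconf' hrest hnodeV hnode0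
  have hC : ∀ s : ℝ, s ≤ σ₁ → (-s) * ‖curl (u s) (ODE.evolutionMap u τ₀ s x₀)‖ ≤ 4 * K := by
    intro s hs
    have hs0 : 0 < -s := by linarith [hs.trans hσ₁τ]
    have h1 := norm_curl_le_four_mul (u s) (X s)
    have h2 := (hK s (by linarith) (X s)).1
    calc (-s) * ‖curl (u s) (X s)‖ ≤ (-s) * (4 * ‖fderiv ℝ (u s) (X s)‖) := mul_le_mul_of_nonneg_left h1 hs0.le
      _ = 4 * ((-s) * ‖fderiv ℝ (u s) (X s)‖) := by ring
      _ ≤ 4 * K := by linarith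
  exact curl_eq_zero_of_eventually_subcritical_along hcl hΛc hΛ hτ₀ hσ₁τ (by linarith : (1 + κ) / 2 < 1) hsub hC

/-- **TAME DSS MEMBERS WITH A SUB-BERNOULLI PRESSURE CLOCK AND DEPLETED SELF-SIMILAR PARTICLE PATHS ARE TRIVIAL.**  Crux hypotheses verbatim (every
`ρ > 0`) + classical + `u(τ,y) = l^{1+ρ}u(l^{2+ρ}τ, ly)`, `p(τ,y) = l^{2+2ρ}p(l^{2+ρ}τ, ly)` (`l > 1`) + tame + pressure clock (`θ < 1`) + for every ball a constant
`κ < 1` DEPLETING its permanent nodes (Chae's rate along the vorticity at vortical phases, the full stretching form at non-vortical phases) ⇒ `u = 0` a.e.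
The clause is vacuous for a member without exactly self-similar particle paths. [folklore] -/
theorem ae_eq_zero_of_gauge_of_dss_of_clock_depletion (hρ : 0 < ρ)
    {H : ℝ → EuclideanSpace ℝ (Fin 3) → EuclideanSpace ℝ (Fin 3) →L[ℝ] EuclideanSpace ℝ (Fin 3)} {c₀ : ℝ≥0}
    (hsw : IsSuitableWeakSolutionOn (slab (EuclideanSpace ℝ (Fin 3)) (Iio 0) isOpen_Iio) 0 0 u p)
    (hH : HasWeakSpatialGradientOn (slab (EuclideanSpace ℝ (Fin 3)) (Iio 0) isOpen_Iio) u H)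
    (hgauge : ∀ a : ℝ, 0 < a →
      ENNReal.ofReal (a ^ (2 * ρ)) * cknA a (0 : ℝ × EuclideanSpace ℝ (Fin 3)) u +
          ENNReal.ofReal (a ^ ρ) * cknE a (0 : ℝ × EuclideanSpace ℝ (Fin 3)) H +
        ENNReal.ofReal (a ^ (2 * ρ)) * cknD a (0 : ℝ × EuclideanSpace ℝ (Fin 3)) p ≤ (c₀ : ℝ≥0∞))
    (hcl : IsClassicalEulerSolutionOn (Iio 0) 0 u p) (hl : 1 < l)
    (hdss : ∀ τ : ℝ, τ < 0 → ∀ y, u τ y = (l ^ (1 + ρ)) • u ((l ^ (2 + ρ)) * τ) (l • y))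
    (hpdss : ∀ τ : ℝ, τ < 0 → ∀ y, p τ y = l ^ (2 + 2 * ρ) * p ((l ^ (2 + ρ)) * τ) (l • y))
    (htame : ∀ s t : ℝ, s < t → t < 0 → ∃ B : ℝ, ∀ τ ∈ Icc s t, ∀ y : EuclideanSpace ℝ (Fin 3),
      ‖u τ y‖ ≤ B ∧ ‖fderiv ℝ (u τ) y‖ ≤ B)
    (hθ : θ < 1)
    (hclock : ∀ s : ℝ, s < 0 → ∀ x : EuclideanSpace ℝ (Fin 3),
      (-s) * timeDerivWithin (Iio 0) p s x - (2 + ρ)⁻¹ * fderiv ℝ (p s) x x - 2 * (1 - (2 + ρ)⁻¹) * p s x ≤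
        θ * (1 - 2 * (2 + ρ)⁻¹) * ‖u s x + ((2 + ρ)⁻¹ / (-s)) • x‖ ^ 2)
    (hnodes : ∀ R : ℝ, 0 < R → ∃ κ : ℝ, κ < 1 ∧
      (∀ y : EuclideanSpace ℝ (Fin 3), ‖y‖ ≤ R →
        (∀ t : ℝ, t < 0 → u t ((-t) ^ (2 + ρ)⁻¹ • y) = (-((2 + ρ)⁻¹ * (-t) ^ ((2 + ρ)⁻¹ - 1))) • y) →
        ∀ t : ℝ, t < 0 → curl (u t) ((-t) ^ (2 + ρ)⁻¹ • y) ≠ 0 →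
          (-t) * ⟪fderiv ℝ (u t) ((-t) ^ (2 + ρ)⁻¹ • y) (curl (u t) ((-t) ^ (2 + ρ)⁻¹ • y)), curl (u t) ((-t) ^ (2 + ρ)⁻¹ • y)⟫ ≤
            κ * ‖curl (u t) ((-t) ^ (2 + ρ)⁻¹ • y)‖ ^ 2) ∧
      (∀ y : EuclideanSpace ℝ (Fin 3), ‖y‖ ≤ R →
        (∀ t : ℝ, t < 0 → u t ((-t) ^ (2 + ρ)⁻¹ • y) = (-((2 + ρ)⁻¹ * (-t) ^ ((2 + ρ)⁻¹ - 1))) • y) →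
        ∀ t : ℝ, t < 0 → curl (u t) ((-t) ^ (2 + ρ)⁻¹ • y) = 0 → ∀ v : EuclideanSpace ℝ (Fin 3),
          (-t) * ⟪fderiv ℝ (u t) ((-t) ^ (2 + ρ)⁻¹ • y) v, v⟫ ≤ κ * ‖v‖ ^ 2)) :
    uncurry u =ᵐ[volume.restrict (Iio (0 : ℝ) ×ˢ (univ : Set (EuclideanSpace ℝ (Fin 3))))] 0 := by
  have hρ2 : 0 < 2 + ρ := by linarith
  have hl0 : 0 < l := zero_lt_one.trans hl
  have hn0 : 0 < (2 + ρ)⁻¹ := inv_pos.2 hρ2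
  obtain ⟨B, hB⟩ := htame (-(l ^ (2 + ρ))) (-1) (by linarith [Real.one_lt_rpow hl hρ2]) (by norm_num)
  have hK := exists_typeI_of_dss_tame hl hρ2 (by linarith) hdss hB
  set K : ℝ := l ^ (2 + ρ) * B with hKdef
  have hΛc : ContinuousOn (fun s : ℝ => K / (-s)) (Iio 0) :=
    continuousOn_const.div continuousOn_neg fun s hs => by rw [mem_Iio] at hs; linarith
  have hΛ : ∀ s : ℝ, s < 0 → ∀ y, ‖fderiv ℝ (u s) y‖ ≤ K / (-s) := fun s hs y => by
    rw [le_div_iff₀ (by linarith), mul_comm]; exact (hK s hs y).1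
  refine ae_eq_zero_of_gauge_of_piercing_of_confinedNull_allRho (n := (2 + ρ)⁻¹) hρ hsw hH hgauge hcl hΛc hΛ
    (fun R₀ => ?_) (fun τ₀ hτ₀ R hR => ?_)
  · set R : ℝ := max R₀ (K / (2 + ρ)⁻¹ + 1) with hRdef
    have hbR : K < (2 + ρ)⁻¹ * R := by
      have h1 : K / (2 + ρ)⁻¹ + 1 ≤ R := le_max_right _ _
      have h2 : K / (2 + ρ)⁻¹ < R := by linarith
      rwa [div_lt_iff₀ hn0, mul_comm] at h2
    exact ⟨R, le_max_left _ _, fun σ hσ x hx hfast =>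
      absurd hfast (not_le.2 (noFastInflow_of_boundedSpeed hσ hbR (fun y _ => (hK σ hσ y).2) hx))⟩
  · obtain ⟨P₀, G, hPG⟩ := exists_pressure_core_bounds_of_dss hcl.smooth_pressure hl hρ2 hpdss R
    obtain ⟨κ, hκ, hnodeV, hnode0⟩ := hnodes R hR
    have hempty : {x : EuclideanSpace ℝ (Fin 3) | curl (u τ₀) x ≠ 0 ∧
        ∀ σ : ℝ, σ ≤ τ₀ → ‖ODE.evolutionMap u τ₀ σ x‖ < R * (-σ) ^ (2 + ρ)⁻¹} = ∅ := by
      refine eq_empty_iff_forall_notMem.2 fun x hx => hx.1 ?_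
      exact dss_curl_eq_zero_of_confined_depletion hcl hρ hl hdss hK hθ hclock hκ (fun s hs y hy => (hPG s hs y hy).1)
        (fun s hs y hy => (hPG s hs y hy).2) hnodeV hnode0 hτ₀ fun s hs => (hx.2 s hs).le
    rw [hempty, measure_empty]

end Summit.NavierStokesRegularity.NavierStokesRegularity.Theorems.PowerGaugeEulerLiouville.SimilarityBernoulli

end
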